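import Mathlib
import Summits.MatrixMultiplication.MatrixMultiplication.Theses.FidelityWitnesses
import Summits.MatrixMultiplication.MatrixMultiplication.Theorems.LinearDefectLaw.Negative.TwoByTwoRungs

/-!
# `FidelityWitnesses.SevenEighthsLaw` is the `(2,6)` instance of `LinearDefectLaw`, and what it buys

Support item `stmt-MatrixMultiplication-4959` (`SevenEighthsLaw`, `M(2,6) = 7`: no tensor of rank `≤ 6`
captures more than `7/8` of `⟨2,2,2⟩`) of route `MatrixMultiplication/FidelityWitnesses`.

* `sevenEighthsLaw_of_linearDefectLaw` — the item is, verbatim, the `(n, r) = (2, 6)` instance of the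
  route's structural conjecture `LinearDefectLaw` (`stmt-MatrixMultiplication-14039`,
  `|⟨S,⟨n,n,n⟩⟩|² ≤ (n³ + r − R̲(⟨n,n,n⟩))·‖S‖²`): with the tree theorem `R̲(⟨2,2,2⟩) = 7`
  (`linearDefectLaw_two`: `M(2,r) ≤ r + 1`) the constant at `r = 6` is `7`.  Kernel-checked glue, so that a
  proof of `LinearDefectLaw` closes this item mechanically (same shape as
  `sixEighthsAtFive_of_linearDefectLaw` one rung down).
* `fidelityGapTwoSix_of_sevenEighthsLaw`, `fidelityGapTwoSixExplicit_of_sevenEighthsLaw` — downwards,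
  `SevenEighthsLaw` is the EFFECTIVE form of the (closed, ineffective) crux `FidelityGapTwoSix`
  (`ε = 1/8`) and implies the calibration item `FidelityGapTwoSixExplicit` (`ε = 10⁻⁵`), since
  `7 ≤ (1 − 10⁻⁵)·8`.

So the ladder at the first border instance reads
`LinearDefectLaw ⟹ SevenEighthsLaw ⟹ FidelityGapTwoSixExplicit ⟹ FidelityGapTwoSix (⟺ R̲(⟨2,2,2⟩) = 7)`.
-/

set_option linter.dupNamespace false

namespace Summit.MatrixMultiplication.MatrixMultiplication.Theorems

open scoped BigOperators
open Literature.Computability.AlgebraicComplexity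
open Summit.MatrixMultiplication.MatrixMultiplication.Theses.FidelityWitnesses

/-- **`LinearDefectLaw ⟹ SevenEighthsLaw`.** The linear defect law at `(n, r) = (2, 6)` reads
`|⟨S,⟨2,2,2⟩⟩|² ≤ (6 + 1)·‖S‖²` once `R̲(⟨2,2,2⟩) = 7` is substituted (`linearDefectLaw_two`), which is
`SevenEighthsLaw`. [folklore] -/
theorem sevenEighthsLaw_of_linearDefectLaw (h : LinearDefectLaw) : SevenEighthsLaw := by
  intro S hS
  have key := linearDefectLaw_two h 6 S hS
  have e : ((6 : ℕ) : ℝ) + 1 = 7 := by norm_num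
  rw [e] at key
  exact key

/-- **`SevenEighthsLaw ⟹ FidelityGapTwoSix` with the explicit gap `ε = 1/8`:**
`7 = (1 − 1/8)·8`. [folklore] -/
theorem fidelityGapTwoSix_of_sevenEighthsLaw (h : SevenEighthsLaw) : FidelityGapTwoSix := by
  refine ⟨1 / 8, by norm_num, fun S hS => ?_⟩
  have key := h S hS
  have e : (1 - 1 / 8 : ℝ) * 8 = 7 := by norm_num
  rw [e]
  exact key

/-- **`SevenEighthsLaw ⟹ FidelityGapTwoSixExplicit`** (`ε = 10⁻⁵`): `7 ≤ (1 − 10⁻⁵)·8 = 7.99992`.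
[folklore] -/
theorem fidelityGapTwoSixExplicit_of_sevenEighthsLaw (h : SevenEighthsLaw) :
    FidelityGapTwoSixExplicit := by
  intro S hS
  have key := h S hS
  have hnn : (0 : ℝ) ≤ ∑ a, ∑ b, ∑ c, ‖S a b c‖ ^ 2 := by positivity
  calc ‖∑ a, ∑ b, ∑ c, S a b c * matMulTensor ℂ 2 2 2 a b c‖ ^ 2
      ≤ 7 * ∑ a, ∑ b, ∑ c, ‖S a b c‖ ^ 2 := key
    _ ≤ (1 - 1 / 100000) * 8 * ∑ a, ∑ b, ∑ c, ‖S a b c‖ ^ 2 :=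
        mul_le_mul_of_nonneg_right (by norm_num) hnn

end Summit.MatrixMultiplication.MatrixMultiplication.Theorems
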